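import Mathlib
import HarnessLib
import Literature.MathematicalPhysics.StatisticalMechanics.PolymerProductBound

/-!
# Differences of block products: `F^Z − F'^Z = Σ_{∅ ≠ S ⊆ Z} (F − F')^S F'^{Z∖S}` and the norm bound
# `|F^Z − F'^Z|_{T, W^Z} ≤ ∏_B (a_B + δ_B) − ∏_B a_B` ([ABKM19] Ch. 9, derivatives of `P₁`, `P₂`)

In [ABKM19] Lemmas 9.4–9.6 the maps `P₂(I,K) = (I − 1) ∘ K` and `P₁(I₁,I₂,J,K)` are polynomial in the
block functionals, and their derivatives `D_I P(I, …)(İ, …)` replace one block factor by the direction.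
In the derivative-free (Lipschitz) form used in the tree this is the binomial identity
`F^Z − F'^Z = Σ_{S ∈ 𝓟(Z), S ≠ ∅} (F − F')^S F'^{Z∖S}` and the resulting estimate: if
`|F'(B)|_{T_B, W^B} ≤ a_B` and `|F(B) − F'(B)|_{T_B, W^B} ≤ δ_B` on the blocks of `Z`, then
`|F^Z − F'^Z|_{T, W^Z} ≤ ∏_{B}(a_B + δ_B) − ∏_B a_B` (`≤ |Z| δ (a+δ)^{|Z|−1}` for constant bounds).

* `bprod_sub_bprod_eq_sum` — the identity (any commutative ring);
* **`tayNormLE_bprod_sub_bprod`** — the norm bound.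

Everything is proved; no named fact.

## References
* S. Adams, S. Buchholz, R. Kotecký, S. Müller, arXiv:1910.13564, Lemma 9.4 (9.20), Lemma 9.6
  (derivative bounds) [AdamsBuchholzKoteckyMuller2019].
-/

noncomputable section

namespace Literature.MathematicalPhysics.StatisticalMechanics.GradientRG

open scoped BigOperators Classical
open Finset
open Literature.MathematicalPhysics.StatisticalMechanics.TorusPolymer
  (IsPolymer blocks polys pcirc bprod mem_polys isPolymer_empty pcirc_bprod_bprod)
open Literature.MathematicalPhysics.QuantumFieldTheory

variable {d M : ℕ} [NeZero M]

/-- **`F^Z − F'^Z = Σ_{S ∈ 𝓟_s(Z), S ≠ ∅} (F − F')^S F'^{Z∖S}`** for an `s`-polymer `Z` (binomial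
expansion of `((F − F') + F')^Z`). [cite: AdamsBuchholzKoteckyMuller2019, Lemma 9.4 (9.20)] -/
theorem bprod_sub_bprod_eq_sum {R : Type*} [CommRing R] {s : ℕ} (F F' : Finset (Fin d → ZMod M) → R)
    {Z : Finset (Fin d → ZMod M)} (hZ : IsPolymer s Z) :
    bprod s F Z - bprod s F' Z =
      ∑ S ∈ (polys s Z).erase ∅, bprod s (fun B => F B - F' B) S * bprod s F' (Z \ S) := by
  have h := pcirc_bprod_bprod (fun B => F B - F' B) F' hZ
  simp only [sub_add_cancel] at h
  have h0 : (∅ : Finset (Fin d → ZMod M)) ∈ polys s Z := mem_polys.2 ⟨empty_subset _, isPolymer_empty s⟩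
  unfold TorusPolymer.pcirc at h
  rw [← Finset.add_sum_erase _ _ h0] at h
  simp only [TorusPolymer.bprod_empty, one_mul, sdiff_empty] at h
  rw [← h]
  ring

variable {V : Type*} [NormedAddCommGroup V] [NormedSpace ℝ V]
  {Vb : Finset (Fin d → ZMod M) → Type*} [∀ B, NormedAddCommGroup (Vb B)] [∀ B, NormedSpace ℝ (Vb B)]

/-- **`|F^Z − F'^Z|_{T, W^Z} ≤ ∏_{B ∈ 𝓑(Z)} (a_B + δ_B) − ∏_B a_B`** for block functionals with
`|F'(B)|_{T_B,W^B} ≤ a_B`, `|F(B) − F'(B)|_{T_B,W^B} ≤ δ_B` (`a, δ ≥ 0`, block gauges `T_B ≤ T`,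
`C^{r₀}`, local), `Z` an `s`-polymer, weight `W^Z = ∏_B W^B`.
[cite: AdamsBuchholzKoteckyMuller2019, Lemma 9.4 (9.20)] -/
theorem tayNormLE_bprod_sub_bprod (s : ℕ) (T : ((Fin d → ZMod M) → ℝ) →ₗ[ℝ] V)
    (Tb : ∀ B : Finset (Fin d → ZMod M), ((Fin d → ZMod M) → ℝ) →ₗ[ℝ] Vb B) {r₀ : ℕ}
    {W : Finset (Fin d → ZMod M) → ((Fin d → ZMod M) → ℝ) → ℝ}
    {F F' : Finset (Fin d → ZMod M) → ((Fin d → ZMod M) → ℝ) → ℂ} {a δ : Finset (Fin d → ZMod M) → ℝ}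
    {Z : Finset (Fin d → ZMod M)} (hZ : IsPolymer s Z)
    (hF' : ∀ B ∈ blocks s Z, TayNormLE (Tb B) r₀ (W B) (F' B) (a B))
    (hΔ : ∀ B ∈ blocks s Z, TayNormLE (Tb B) r₀ (W B) (fun φ => F B φ - F' B φ) (δ B))
    (hle : ∀ B ∈ blocks s Z, ∀ ξ, ‖Tb B ξ‖ ≤ ‖T ξ‖)
    (hFd : ∀ B ∈ blocks s Z, ContDiff ℝ r₀ (F B)) (hF'd : ∀ B ∈ blocks s Z, ContDiff ℝ r₀ (F' B))
    (hFloc : ∀ B ∈ blocks s Z, IsGaugeLocal (Tb B) (F B)) (hF'loc : ∀ B ∈ blocks s Z, IsGaugeLocal (Tb B) (F' B))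
    (ha : ∀ B ∈ blocks s Z, 0 ≤ a B) (hδ : ∀ B ∈ blocks s Z, 0 ≤ δ B) :
    TayNormLE T r₀ (fun φ => ∏ B ∈ blocks s Z, W B φ)
      (fun φ => bprod s (fun B => F B φ) Z - bprod s (fun B => F' B φ) Z)
      ((∏ B ∈ blocks s Z, (a B + δ B)) - ∏ B ∈ blocks s Z, a B) := by
  -- rewrite the functional and the constant by the binomial identity
  have hfun : (fun φ => bprod s (fun B => F B φ) Z - bprod s (fun B => F' B φ) Z) = fun φ =>
      ∑ S ∈ (polys s Z).erase ∅, bprod s (fun B => F B φ - F' B φ) S * bprod s (fun B => F' B φ) (Z \ S) := by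
    funext φ; exact bprod_sub_bprod_eq_sum (fun B => F B φ) (fun B => F' B φ) hZ
  have hconst : (∏ B ∈ blocks s Z, (a B + δ B)) - ∏ B ∈ blocks s Z, a B =
      ∑ S ∈ (polys s Z).erase ∅, (∏ B ∈ blocks s S, δ B) * ∏ B ∈ blocks s (Z \ S), a B := by
    have h := bprod_sub_bprod_eq_sum (fun B => a B + δ B) a hZ
    simp only [TorusPolymer.bprod, add_sub_cancel_left] at h
    exact h
  rw [hfun, hconst]
  have hΔd : ∀ B ∈ blocks s Z, ContDiff ℝ r₀ (fun φ => F B φ - F' B φ) := fun B hB => (hFd B hB).sub (hF'd B hB)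
  have hΔloc : ∀ B ∈ blocks s Z, IsGaugeLocal (Tb B) (fun φ => F B φ - F' B φ) := fun B hB φ ψ h => by
    show F B φ - F' B φ = F B ψ - F' B ψ
    rw [hFloc B hB φ ψ h, hF'loc B hB φ ψ h]
  have hcd : ∀ {G : Finset (Fin d → ZMod M) → ((Fin d → ZMod M) → ℝ) → ℂ} {Y : Finset (Fin d → ZMod M)},
      (∀ B ∈ blocks s Y, ContDiff ℝ r₀ (G B)) → ContDiff ℝ r₀ (fun φ => bprod s (fun B => G B φ) Y) := by
    intro G Y hG
    unfold TorusPolymer.bprod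
    exact contDiff_prod fun B hB => hG B hB
  have hlc : ∀ {G : Finset (Fin d → ZMod M) → ((Fin d → ZMod M) → ℝ) → ℂ} {Y : Finset (Fin d → ZMod M)},
      (∀ B ∈ blocks s Y, IsGaugeLocal (Tb B) (G B)) → (∀ B ∈ blocks s Y, ∀ ξ, ‖Tb B ξ‖ ≤ ‖T ξ‖) →
        IsGaugeLocal T (fun φ => bprod s (fun B => G B φ) Y) := by
    intro G Y hG hle'
    unfold TorusPolymer.bprod
    exact IsGaugeLocal.prod _ fun B hB => (hG B hB).of_norm_le (hle' B hB)
  refine TayNormLE.sum (T := T) (r₀ := r₀) ((polys s Z).erase ∅) (fun S hS => ?_) (fun S hS => ?_)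
  · obtain ⟨hSZ, hSp⟩ := mem_polys.1 (mem_of_mem_erase hS)
    have hsubS : blocks s S ⊆ blocks s Z := TorusPolymer.blocks_mono s hSZ
    have hsubD : blocks s (Z \ S) ⊆ blocks s Z := TorusPolymer.blocks_mono s sdiff_subset
    have h1 := tayNormLE_bprod s T Tb S (fun B hB => hΔ B (hsubS hB)) (fun B hB => hle B (hsubS hB))
      (fun B hB => hΔd B (hsubS hB)) (fun B hB => hΔloc B (hsubS hB)) (fun B hB => hδ B (hsubS hB))
    have h2 := tayNormLE_bprod s T Tb (Z \ S) (fun B hB => hF' B (hsubD hB)) (fun B hB => hle B (hsubD hB))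
      (fun B hB => hF'd B (hsubD hB)) (fun B hB => hF'loc B (hsubD hB)) (fun B hB => ha B (hsubD hB))
    refine TayNormLE.mul (T := T) h1 h2 (fun ξ => le_rfl) (fun ξ => le_rfl)
      (hcd fun B hB => hΔd B (hsubS hB)) (hcd fun B hB => hF'd B (hsubD hB))
      (hlc (fun B hB => hΔloc B (hsubS hB)) fun B hB => hle B (hsubS hB))
      (hlc (fun B hB => hF'loc B (hsubD hB)) fun B hB => hle B (hsubD hB))
      (Finset.prod_nonneg fun B hB => hδ B (hsubS hB)) (Finset.prod_nonneg fun B hB => ha B (hsubD hB))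
      (fun φ => ?_)
    -- `W^S W^{Z∖S} = W^Z`
    have hu : S ∪ Z \ S = Z := union_sdiff_of_subset hSZ
    have h := TorusPolymer.bprod_union (fun B => W B φ) hSp (hZ.sdiff hSp) disjoint_sdiff
    rw [hu] at h
    simp only [TorusPolymer.bprod] at h
    rw [h]
  · obtain ⟨hSZ, -⟩ := mem_polys.1 (mem_of_mem_erase hS)
    have hsubS : blocks s S ⊆ blocks s Z := TorusPolymer.blocks_mono s hSZ
    have hsubD : blocks s (Z \ S) ⊆ blocks s Z := TorusPolymer.blocks_mono s sdiff_subset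
    exact (hcd fun B hB => hΔd B (hsubS hB)).mul (hcd fun B hB => hF'd B (hsubD hB))

end Literature.MathematicalPhysics.StatisticalMechanics.GradientRG

end
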